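import Summits.CriticalPhenomena.PercolationContinuityZ3.Theorems.PercNearOneGluingNoHeavyLowerTailAntipodalR1CutVertexGrades
import Summits.CriticalPhenomena.PercolationContinuityZ3.Theorems.PercNearOneGluingNoHeavyLowerTailAntipodalR1OneSumApexCut
import Summits.CriticalPhenomena.PercolationContinuityZ3.Theorems.PercNearOneGluingNoHeavyLowerTailAntipodalR1TwoCutGrades
import HarnessLib

/-!
# ANTI₁ across a cut vertex, graded: a terminal block

Support file for `stmt-CriticalPhenomena-4575` (memo `prim-gen-kcluster/KCLUSTER-gen73.md` §1.8 (C)/(D),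
graded; conjecture ANTI₁-GRADED of `KCLUSTER-gen52.md` §3).  No definitions, no named facts, no sorries.
Vocabulary of `AntipodalR1` (gen 62); `…OneSumTerminal` (the ungraded case, its anatomy lemmas
`mem_lSet_terminalBlock`, `mem_rSet_terminalBlock_of_M`, `mem_rSet_terminalBlock_of_rSet`),
`…CutVertexGrades` (grade shift `g_G(ω_N ⊕ ω_F) + 2·#I_F = g_N(ω_N) + c^F(ω_F)`, `c^F(ω̄_F) = c^F(ω_F)`)
and `card_filter_add_le` (part VII) of gen 78.

**Theorem** (`card_lSet_grade_le_of_terminalBlock`).  `G = N ∪ F` glued at the single vertex `u`, the apex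
`a` and the terminal `b` on the near side, the terminal `c` interior to `F`.  Then ANTI₁-GRADED for
`(N; a, b, u)` implies ANTI₁-GRADED for `(G; a, b, c)`, at every level; and (`…_of_terminalCut`) when the
shared vertex is the terminal `b` itself, ANTI₁-GRADED holds outright (`L = ∅`).  The proof is the
fibrewise pairing `ω_F ↔ ω̄_F` of the ungraded file; every embedding shifts the grade by the constant
`c^F(ω_F) − 2·#I_F` (`fibre_grade_le_terminalBlock`).  [this work]
-/

namespace Summit.CriticalPhenomena.PercolationContinuityZ3.Theorems

namespace AntipodalR1

open Finset Relation SimpleGraph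

variable {V ιN ιF : Type*}

section Sets

variable {endsN : ιN → Sym2 V} {endsF : ιF → Sym2 V} {u a b c : V}
variable [Fintype V] [Fintype ιN] [DecidableEq ιN] [Fintype ιF] [DecidableEq ιF]

open Classical in
/-- **The paired graded fibre inequality** for a terminal block: the `L(G)`-fibre over `ω_F` at level
`t` is no larger than the `R(G)`-fibre over `ω̄_F` at level `t`. [this work] -/
theorem fibre_grade_le_terminalBlock
    (hsep : ∀ w i, w ∈ endsN i → ∀ j, w ∈ endsF j → w = u) (ha : ∀ j, a ∈ endsF j → a = u)
    (hb : ∀ j, b ∈ endsF j → b = u) (hcF : ∃ j, c ∈ endsF j) (hcu : c ≠ u)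
    (h0 : ∀ t, (univ.filter fun ωN : ιN → Bool => ωN ∈ lSet endsN a b u ∧
        (Nat.card (fromEdgeSet {s : Sym2 V | ∃ i, ωN i = true ∧ endsN i = s}).ConnectedComponent +
        Nat.card (fromEdgeSet {s : Sym2 V | ∃ i, ωN i = false ∧ endsN i = s}).ConnectedComponent) = t).card ≤
      (univ.filter fun ωN : ιN → Bool => ωN ∈ rSet endsN a b u ∧
        (Nat.card (fromEdgeSet {s : Sym2 V | ∃ i, ωN i = true ∧ endsN i = s}).ConnectedComponent +
        Nat.card (fromEdgeSet {s : Sym2 V | ∃ i, ωN i = false ∧ endsN i = s}).ConnectedComponent) = t).card)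
    (ωF : ιF → Bool) (t : ℕ) :
    (univ.filter fun ωN : ιN → Bool => Sum.elim ωN ωF ∈ lSet (Sum.elim endsN endsF) a b c ∧
        (Nat.card (fromEdgeSet {s : Sym2 V | ∃ e, Sum.elim ωN ωF e = true ∧
          Sum.elim endsN endsF e = s}).ConnectedComponent +
        Nat.card (fromEdgeSet {s : Sym2 V | ∃ e, Sum.elim ωN ωF e = false ∧
          Sum.elim endsN endsF e = s}).ConnectedComponent) = t).card ≤
      (univ.filter fun ωN : ιN → Bool => Sum.elim ωN (fun j => !ωF j) ∈ rSet (Sum.elim endsN endsF) a b c ∧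
        (Nat.card (fromEdgeSet {s : Sym2 V | ∃ e, Sum.elim ωN (fun j => !ωF j) e = true ∧
          Sum.elim endsN endsF e = s}).ConnectedComponent +
        Nat.card (fromEdgeSet {s : Sym2 V | ∃ e, Sum.elim ωN (fun j => !ωF j) e = false ∧
          Sum.elim endsN endsF e = s}).ConnectedComponent) = t).card := by
  have hflip : ∀ col, c ∈ clus endsF (fun j => !ωF j) col u ↔ c ∈ clus endsF ωF (!col) u :=
    fun col => mem_clus_flip endsF ωF col u c
  -- grade bookkeeping: `g_G(ω_N ⊕ ω_F) + 2 #I = g_N(ω_N) + k` and the same `k` for `ω̄_F`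
  have hg : ∀ ωN : ιN → Bool, (Nat.card (fromEdgeSet {s : Sym2 V | ∃ e, Sum.elim ωN ωF e = true ∧
          Sum.elim endsN endsF e = s}).ConnectedComponent +
        Nat.card (fromEdgeSet {s : Sym2 V | ∃ e, Sum.elim ωN ωF e = false ∧
          Sum.elim endsN endsF e = s}).ConnectedComponent) +
      2 * Nat.card {w : V | ¬ ∀ j, w ∈ endsF j → w = u} =
      (Nat.card (fromEdgeSet {s : Sym2 V | ∃ i, ωN i = true ∧ endsN i = s}).ConnectedComponent +
        Nat.card (fromEdgeSet {s : Sym2 V | ∃ i, ωN i = false ∧ endsN i = s}).ConnectedComponent) +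
      (Nat.card {D : (fromEdgeSet {s : Sym2 V | ∃ j, ωF j = true ∧ endsF j = s}).ConnectedComponent //
            ¬ ∃ x, x ∉ {w : V | ¬ ∀ j, w ∈ endsF j → w = u} ∧
              (fromEdgeSet {s : Sym2 V | ∃ j, ωF j = true ∧ endsF j = s}).connectedComponentMk x = D} +
          Nat.card {D : (fromEdgeSet {s : Sym2 V | ∃ j, ωF j = false ∧ endsF j = s}).ConnectedComponent //
            ¬ ∃ x, x ∉ {w : V | ¬ ∀ j, w ∈ endsF j → w = u} ∧
              (fromEdgeSet {s : Sym2 V | ∃ j, ωF j = false ∧ endsF j = s}).connectedComponentMk x = D}) :=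
    fun ωN => grade_cutVertex_eq hsep ωN ωF
  have hg' : ∀ ωN : ιN → Bool, (Nat.card (fromEdgeSet {s : Sym2 V | ∃ e, Sum.elim ωN (fun j => !ωF j) e = true ∧
          Sum.elim endsN endsF e = s}).ConnectedComponent +
        Nat.card (fromEdgeSet {s : Sym2 V | ∃ e, Sum.elim ωN (fun j => !ωF j) e = false ∧
          Sum.elim endsN endsF e = s}).ConnectedComponent) +
      2 * Nat.card {w : V | ¬ ∀ j, w ∈ endsF j → w = u} =
      (Nat.card (fromEdgeSet {s : Sym2 V | ∃ i, ωN i = true ∧ endsN i = s}).ConnectedComponent +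
        Nat.card (fromEdgeSet {s : Sym2 V | ∃ i, ωN i = false ∧ endsN i = s}).ConnectedComponent) +
      (Nat.card {D : (fromEdgeSet {s : Sym2 V | ∃ j, ωF j = true ∧ endsF j = s}).ConnectedComponent //
            ¬ ∃ x, x ∉ {w : V | ¬ ∀ j, w ∈ endsF j → w = u} ∧
              (fromEdgeSet {s : Sym2 V | ∃ j, ωF j = true ∧ endsF j = s}).connectedComponentMk x = D} +
          Nat.card {D : (fromEdgeSet {s : Sym2 V | ∃ j, ωF j = false ∧ endsF j = s}).ConnectedComponent //
            ¬ ∃ x, x ∉ {w : V | ¬ ∀ j, w ∈ endsF j → w = u} ∧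
              (fromEdgeSet {s : Sym2 V | ∃ j, ωF j = false ∧ endsF j = s}).connectedComponentMk x = D}) := by
    intro ωN
    have h1 := grade_cutVertex_eq hsep ωN (fun j => !ωF j)
    have h2 := card_ccInsideT_flip_add (V := V) (u := u) (endsT := endsF) ωF
    omega
  -- the near-side sets at the shifted level
  set k := (Nat.card {D : (fromEdgeSet {s : Sym2 V | ∃ j, ωF j = true ∧ endsF j = s}).ConnectedComponent //
            ¬ ∃ x, x ∉ {w : V | ¬ ∀ j, w ∈ endsF j → w = u} ∧
              (fromEdgeSet {s : Sym2 V | ∃ j, ωF j = true ∧ endsF j = s}).connectedComponentMk x = D} +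
          Nat.card {D : (fromEdgeSet {s : Sym2 V | ∃ j, ωF j = false ∧ endsF j = s}).ConnectedComponent //
            ¬ ∃ x, x ∉ {w : V | ¬ ∀ j, w ∈ endsF j → w = u} ∧
              (fromEdgeSet {s : Sym2 V | ∃ j, ωF j = false ∧ endsF j = s}).connectedComponentMk x = D}) with hk
  set T := t + 2 * Nat.card {w : V | ¬ ∀ j, w ∈ endsF j → w = u} with hT
  have hdisj : Disjoint (univ.filter fun ωN : ιN → Bool => (b ∈ clus endsN ωN true a ∧
        b ∉ clus endsN ωN false a ∧ u ∈ clus endsN ωN true a ∧ u ∈ clus endsN ωN false a) ∧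
      (Nat.card (fromEdgeSet {s : Sym2 V | ∃ i, ωN i = true ∧ endsN i = s}).ConnectedComponent +
        Nat.card (fromEdgeSet {s : Sym2 V | ∃ i, ωN i = false ∧ endsN i = s}).ConnectedComponent) + k = T)
      (univ.filter fun ωN : ιN → Bool => ωN ∈ rSet endsN a b u ∧
      (Nat.card (fromEdgeSet {s : Sym2 V | ∃ i, ωN i = true ∧ endsN i = s}).ConnectedComponent +
        Nat.card (fromEdgeSet {s : Sym2 V | ∃ i, ωN i = false ∧ endsN i = s}).ConnectedComponent) + k = T) := by
    refine disjoint_left.2 fun ωN h1 h2 => ?_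
    exact (mem_filter.1 (mem_filter.1 h2).2.1).2.2.2.2 (mem_filter.1 h1).2.1.2.2.1
  have hshift := card_filter_add_le _ _ _ _ h0 k T
  by_cases hcO : c ∈ clus endsF ωF true u
  · by_cases hcK : c ∈ clus endsF ωF false u
    · -- `ω_F ∈ Y ∖ X`
      calc (univ.filter fun ωN : ιN → Bool => Sum.elim ωN ωF ∈ lSet (Sum.elim endsN endsF) a b c ∧
        (Nat.card (fromEdgeSet {s : Sym2 V | ∃ e, Sum.elim ωN ωF e = true ∧
          Sum.elim endsN endsF e = s}).ConnectedComponent +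
        Nat.card (fromEdgeSet {s : Sym2 V | ∃ e, Sum.elim ωN ωF e = false ∧
          Sum.elim endsN endsF e = s}).ConnectedComponent) = t).card
          ≤ (univ.filter fun ωN : ιN → Bool => ωN ∈ lSet endsN a b u ∧
              (Nat.card (fromEdgeSet {s : Sym2 V | ∃ i, ωN i = true ∧ endsN i = s}).ConnectedComponent +
        Nat.card (fromEdgeSet {s : Sym2 V | ∃ i, ωN i = false ∧ endsN i = s}).ConnectedComponent) + k = T).card := by
            refine card_le_card fun ωN h => ?_
            obtain ⟨hL, hgr⟩ := (mem_filter.1 h).2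
            refine mem_filter.2 ⟨mem_univ _, ?_, by have := hg ωN; omega⟩
            rcases (mem_lSet_terminalBlock hsep ha hb hcF hcu hL).2.2.2.2 with ⟨-, h'⟩ | ⟨-, h'⟩
            · exact (h' hcK).elim
            · exact h'
        _ ≤ (univ.filter fun ωN : ιN → Bool => ωN ∈ rSet endsN a b u ∧
              (Nat.card (fromEdgeSet {s : Sym2 V | ∃ i, ωN i = true ∧ endsN i = s}).ConnectedComponent +
        Nat.card (fromEdgeSet {s : Sym2 V | ∃ i, ωN i = false ∧ endsN i = s}).ConnectedComponent) + k = T).card := hshift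
        _ ≤ _ := by
            refine card_le_card fun ωN h => ?_
            obtain ⟨hR, hgr⟩ := (mem_filter.1 h).2
            refine mem_filter.2 ⟨mem_univ _,
              mem_rSet_terminalBlock_of_rSet hsep ha hb hcF hcu hR ((hflip false).2 hcO), ?_⟩
            have := hg' ωN; omega
    · -- `ω_F ∈ X`
      calc (univ.filter fun ωN : ιN → Bool => Sum.elim ωN ωF ∈ lSet (Sum.elim endsN endsF) a b c ∧
        (Nat.card (fromEdgeSet {s : Sym2 V | ∃ e, Sum.elim ωN ωF e = true ∧
          Sum.elim endsN endsF e = s}).ConnectedComponent +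
        Nat.card (fromEdgeSet {s : Sym2 V | ∃ e, Sum.elim ωN ωF e = false ∧
          Sum.elim endsN endsF e = s}).ConnectedComponent) = t).card
          ≤ ((univ.filter fun ωN : ιN → Bool => (b ∈ clus endsN ωN true a ∧
        b ∉ clus endsN ωN false a ∧ u ∈ clus endsN ωN true a ∧ u ∈ clus endsN ωN false a) ∧
              (Nat.card (fromEdgeSet {s : Sym2 V | ∃ i, ωN i = true ∧ endsN i = s}).ConnectedComponent +
        Nat.card (fromEdgeSet {s : Sym2 V | ∃ i, ωN i = false ∧ endsN i = s}).ConnectedComponent) + k = T) ∪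
             (univ.filter fun ωN : ιN → Bool => ωN ∈ lSet endsN a b u ∧
              (Nat.card (fromEdgeSet {s : Sym2 V | ∃ i, ωN i = true ∧ endsN i = s}).ConnectedComponent +
        Nat.card (fromEdgeSet {s : Sym2 V | ∃ i, ωN i = false ∧ endsN i = s}).ConnectedComponent) + k = T)).card := by
            refine card_le_card fun ωN h => ?_
            obtain ⟨hL, hgr⟩ := (mem_filter.1 h).2
            have hgr' : (Nat.card (fromEdgeSet {s : Sym2 V | ∃ i, ωN i = true ∧ endsN i = s}).ConnectedComponent +
        Nat.card (fromEdgeSet {s : Sym2 V | ∃ i, ωN i = false ∧ endsN i = s}).ConnectedComponent) + k = T := by have := hg ωN; omega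
            obtain ⟨hOb, hKb, huO, -, hor⟩ := mem_lSet_terminalBlock hsep ha hb hcF hcu hL
            rcases hor with ⟨huK, -⟩ | ⟨-, h'⟩
            · exact mem_union_left _ (mem_filter.2 ⟨mem_univ _, ⟨hOb, hKb, huO, huK⟩, hgr'⟩)
            · exact mem_union_right _ (mem_filter.2 ⟨mem_univ _, h', hgr'⟩)
        _ ≤ (univ.filter fun ωN : ιN → Bool => (b ∈ clus endsN ωN true a ∧
        b ∉ clus endsN ωN false a ∧ u ∈ clus endsN ωN true a ∧ u ∈ clus endsN ωN false a) ∧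
              (Nat.card (fromEdgeSet {s : Sym2 V | ∃ i, ωN i = true ∧ endsN i = s}).ConnectedComponent +
        Nat.card (fromEdgeSet {s : Sym2 V | ∃ i, ωN i = false ∧ endsN i = s}).ConnectedComponent) + k = T).card +
            (univ.filter fun ωN : ιN → Bool => ωN ∈ lSet endsN a b u ∧
              (Nat.card (fromEdgeSet {s : Sym2 V | ∃ i, ωN i = true ∧ endsN i = s}).ConnectedComponent +
        Nat.card (fromEdgeSet {s : Sym2 V | ∃ i, ωN i = false ∧ endsN i = s}).ConnectedComponent) + k = T).card := card_union_le _ _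
        _ ≤ (univ.filter fun ωN : ιN → Bool => (b ∈ clus endsN ωN true a ∧
        b ∉ clus endsN ωN false a ∧ u ∈ clus endsN ωN true a ∧ u ∈ clus endsN ωN false a) ∧
              (Nat.card (fromEdgeSet {s : Sym2 V | ∃ i, ωN i = true ∧ endsN i = s}).ConnectedComponent +
        Nat.card (fromEdgeSet {s : Sym2 V | ∃ i, ωN i = false ∧ endsN i = s}).ConnectedComponent) + k = T).card +
            (univ.filter fun ωN : ιN → Bool => ωN ∈ rSet endsN a b u ∧
              (Nat.card (fromEdgeSet {s : Sym2 V | ∃ i, ωN i = true ∧ endsN i = s}).ConnectedComponent +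
        Nat.card (fromEdgeSet {s : Sym2 V | ∃ i, ωN i = false ∧ endsN i = s}).ConnectedComponent) + k = T).card := Nat.add_le_add_left hshift _
        _ = ((univ.filter fun ωN : ιN → Bool => (b ∈ clus endsN ωN true a ∧
        b ∉ clus endsN ωN false a ∧ u ∈ clus endsN ωN true a ∧ u ∈ clus endsN ωN false a) ∧
              (Nat.card (fromEdgeSet {s : Sym2 V | ∃ i, ωN i = true ∧ endsN i = s}).ConnectedComponent +
        Nat.card (fromEdgeSet {s : Sym2 V | ∃ i, ωN i = false ∧ endsN i = s}).ConnectedComponent) + k = T) ∪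
             (univ.filter fun ωN : ιN → Bool => ωN ∈ rSet endsN a b u ∧
              (Nat.card (fromEdgeSet {s : Sym2 V | ∃ i, ωN i = true ∧ endsN i = s}).ConnectedComponent +
        Nat.card (fromEdgeSet {s : Sym2 V | ∃ i, ωN i = false ∧ endsN i = s}).ConnectedComponent) + k = T)).card := (card_union_of_disjoint hdisj).symm
        _ ≤ _ := by
            refine card_le_card fun ωN h => mem_filter.2 ⟨mem_univ _, ?_⟩
            have hgr' : ∀ (_ : (Nat.card (fromEdgeSet {s : Sym2 V | ∃ i, ωN i = true ∧ endsN i = s}).ConnectedComponent +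
        Nat.card (fromEdgeSet {s : Sym2 V | ∃ i, ωN i = false ∧ endsN i = s}).ConnectedComponent) + k = T),
                (Nat.card (fromEdgeSet {s : Sym2 V | ∃ e, Sum.elim ωN (fun j => !ωF j) e = true ∧
          Sum.elim endsN endsF e = s}).ConnectedComponent +
        Nat.card (fromEdgeSet {s : Sym2 V | ∃ e, Sum.elim ωN (fun j => !ωF j) e = false ∧
          Sum.elim endsN endsF e = s}).ConnectedComponent) = t := by
              intro h1; have := hg' ωN; omega
            rcases mem_union.1 h with h1 | h2
            · obtain ⟨⟨hOb, hKb, -, huK⟩, hgr⟩ := (mem_filter.1 h1).2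
              exact ⟨mem_rSet_terminalBlock_of_M hsep ha hb hcF hcu hOb hKb huK
                ((hflip false).2 hcO) (fun h' => hcK ((hflip true).1 h')), hgr' hgr⟩
            · obtain ⟨hR, hgr⟩ := (mem_filter.1 h2).2
              exact ⟨mem_rSet_terminalBlock_of_rSet hsep ha hb hcF hcu hR ((hflip false).2 hcO),
                hgr' hgr⟩
  · -- `c ∉ O_u(F)`: the fibre is empty
    have h00 : (univ.filter fun ωN : ιN → Bool =>
        Sum.elim ωN ωF ∈ lSet (Sum.elim endsN endsF) a b c ∧
        (Nat.card (fromEdgeSet {s : Sym2 V | ∃ e, Sum.elim ωN ωF e = true ∧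
          Sum.elim endsN endsF e = s}).ConnectedComponent +
        Nat.card (fromEdgeSet {s : Sym2 V | ∃ e, Sum.elim ωN ωF e = false ∧
          Sum.elim endsN endsF e = s}).ConnectedComponent) = t) = ∅ :=
      filter_eq_empty_iff.2 fun ωN _ h =>
        hcO (mem_lSet_terminalBlock hsep ha hb hcF hcu h.1).2.2.2.1
    rw [h00, card_empty]
    exact Nat.zero_le _

open Classical in
/-- **The graded 1-sum reduction, terminal block** (memo `KCLUSTER-gen73` §1.8 (C), graded kernel form).
`G = N ∪ F` glued at the single vertex `u`, the apex `a` and the terminal `b` met by edges of `F` only if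
equal to `u`, the terminal `c` interior to `F`.  Then ANTI₁-GRADED for `(N; a, b, u)` implies
ANTI₁-GRADED for `(G; a, b, c)`, at every level.  No other hypothesis on `N`, `F`. [this work] -/
theorem card_lSet_grade_le_of_terminalBlock (endsN : ιN → Sym2 V) (endsF : ιF → Sym2 V)
    (u a b c : V)
    (hsep : ∀ w i, w ∈ endsN i → ∀ j, w ∈ endsF j → w = u) (ha : ∀ j, a ∈ endsF j → a = u)
    (hb : ∀ j, b ∈ endsF j → b = u) (hcF : ∃ j, c ∈ endsF j) (hcu : c ≠ u)
    (h0 : ∀ t, (univ.filter fun ωN : ιN → Bool => ωN ∈ lSet endsN a b u ∧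
        (Nat.card (fromEdgeSet {s : Sym2 V | ∃ i, ωN i = true ∧ endsN i = s}).ConnectedComponent +
        Nat.card (fromEdgeSet {s : Sym2 V | ∃ i, ωN i = false ∧ endsN i = s}).ConnectedComponent) = t).card ≤
      (univ.filter fun ωN : ιN → Bool => ωN ∈ rSet endsN a b u ∧
        (Nat.card (fromEdgeSet {s : Sym2 V | ∃ i, ωN i = true ∧ endsN i = s}).ConnectedComponent +
        Nat.card (fromEdgeSet {s : Sym2 V | ∃ i, ωN i = false ∧ endsN i = s}).ConnectedComponent) = t).card)
    (t : ℕ) :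
    (univ.filter fun x : ιN ⊕ ιF → Bool => x ∈ lSet (Sum.elim endsN endsF) a b c ∧
        (Nat.card (fromEdgeSet {s : Sym2 V | ∃ e, x e = true ∧
          Sum.elim endsN endsF e = s}).ConnectedComponent +
        Nat.card (fromEdgeSet {s : Sym2 V | ∃ e, x e = false ∧
          Sum.elim endsN endsF e = s}).ConnectedComponent) = t).card ≤
      (univ.filter fun x : ιN ⊕ ιF → Bool => x ∈ rSet (Sum.elim endsN endsF) a b c ∧
        (Nat.card (fromEdgeSet {s : Sym2 V | ∃ e, x e = true ∧
          Sum.elim endsN endsF e = s}).ConnectedComponent +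
        Nat.card (fromEdgeSet {s : Sym2 V | ∃ e, x e = false ∧
          Sum.elim endsN endsF e = s}).ConnectedComponent) = t).card := by
  have hfibL : ∀ ωF : ιF → Bool, (univ.filter fun ωN : ιN → Bool => Sum.elim ωN ωF ∈
      univ.filter fun x : ιN ⊕ ιF → Bool => x ∈ lSet (Sum.elim endsN endsF) a b c ∧
        (Nat.card (fromEdgeSet {s : Sym2 V | ∃ e, x e = true ∧
          Sum.elim endsN endsF e = s}).ConnectedComponent +
        Nat.card (fromEdgeSet {s : Sym2 V | ∃ e, x e = false ∧
          Sum.elim endsN endsF e = s}).ConnectedComponent) = t).card =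
      (univ.filter fun ωN : ιN → Bool => Sum.elim ωN ωF ∈ lSet (Sum.elim endsN endsF) a b c ∧
        (Nat.card (fromEdgeSet {s : Sym2 V | ∃ e, Sum.elim ωN ωF e = true ∧
          Sum.elim endsN endsF e = s}).ConnectedComponent +
        Nat.card (fromEdgeSet {s : Sym2 V | ∃ e, Sum.elim ωN ωF e = false ∧
          Sum.elim endsN endsF e = s}).ConnectedComponent) = t).card :=
    fun ωF => congrArg Finset.card (filter_congr fun ωN _ => by
      simp only [mem_filter, mem_univ, true_and])
  have hfibR : ∀ ωF : ιF → Bool, (univ.filter fun ωN : ιN → Bool => Sum.elim ωN ωF ∈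
      univ.filter fun x : ιN ⊕ ιF → Bool => x ∈ rSet (Sum.elim endsN endsF) a b c ∧
        (Nat.card (fromEdgeSet {s : Sym2 V | ∃ e, x e = true ∧
          Sum.elim endsN endsF e = s}).ConnectedComponent +
        Nat.card (fromEdgeSet {s : Sym2 V | ∃ e, x e = false ∧
          Sum.elim endsN endsF e = s}).ConnectedComponent) = t).card =
      (univ.filter fun ωN : ιN → Bool => Sum.elim ωN ωF ∈ rSet (Sum.elim endsN endsF) a b c ∧
        (Nat.card (fromEdgeSet {s : Sym2 V | ∃ e, Sum.elim ωN ωF e = true ∧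
          Sum.elim endsN endsF e = s}).ConnectedComponent +
        Nat.card (fromEdgeSet {s : Sym2 V | ∃ e, Sum.elim ωN ωF e = false ∧
          Sum.elim endsN endsF e = s}).ConnectedComponent) = t).card :=
    fun ωF => congrArg Finset.card (filter_congr fun ωN _ => by
      simp only [mem_filter, mem_univ, true_and])
  rw [card_eq_sum_card_fibre (univ.filter fun x : ιN ⊕ ιF → Bool =>
      x ∈ lSet (Sum.elim endsN endsF) a b c ∧
        (Nat.card (fromEdgeSet {s : Sym2 V | ∃ e, x e = true ∧
          Sum.elim endsN endsF e = s}).ConnectedComponent +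
        Nat.card (fromEdgeSet {s : Sym2 V | ∃ e, x e = false ∧
          Sum.elim endsN endsF e = s}).ConnectedComponent) = t),
    card_eq_sum_card_fibre (univ.filter fun x : ιN ⊕ ιF → Bool =>
      x ∈ rSet (Sum.elim endsN endsF) a b c ∧
        (Nat.card (fromEdgeSet {s : Sym2 V | ∃ e, x e = true ∧
          Sum.elim endsN endsF e = s}).ConnectedComponent +
        Nat.card (fromEdgeSet {s : Sym2 V | ∃ e, x e = false ∧
          Sum.elim endsN endsF e = s}).ConnectedComponent) = t)]
  simp only [hfibL, hfibR]
  rw [← sum_flip_eq (fun ωF => (univ.filter fun ωN : ιN → Bool => Sum.elim ωN ωF ∈ rSet (Sum.elim endsN endsF) a b c ∧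
        (Nat.card (fromEdgeSet {s : Sym2 V | ∃ e, Sum.elim ωN ωF e = true ∧
          Sum.elim endsN endsF e = s}).ConnectedComponent +
        Nat.card (fromEdgeSet {s : Sym2 V | ∃ e, Sum.elim ωN ωF e = false ∧
          Sum.elim endsN endsF e = s}).ConnectedComponent) = t).card)]
  exact sum_le_sum fun ωF _ => fibre_grade_le_terminalBlock hsep ha hb hcF hcu h0 ωF t

open Classical in
/-- **ANTI₁-GRADED when a terminal separates the apex from the other terminal** (memo `KCLUSTER-gen73`
§1.8 (D), graded): `G = N ∪ F` glued at the terminal `b` alone, `a` met by edges of `F` only if `a = b`,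
`c` interior to `F`; then ANTI₁-GRADED holds at every level (indeed `L = ∅`). [this work] -/
theorem card_lSet_grade_le_of_terminalCut (endsN : ιN → Sym2 V) (endsF : ιF → Sym2 V)
    (a b c : V)
    (hsep : ∀ w i, w ∈ endsN i → ∀ j, w ∈ endsF j → w = b) (ha : ∀ j, a ∈ endsF j → a = b)
    (hcF : ∃ j, c ∈ endsF j) (hcb : c ≠ b) (t : ℕ) :
    (univ.filter fun x : ιN ⊕ ιF → Bool => x ∈ lSet (Sum.elim endsN endsF) a b c ∧
        (Nat.card (fromEdgeSet {s : Sym2 V | ∃ e, x e = true ∧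
          Sum.elim endsN endsF e = s}).ConnectedComponent +
        Nat.card (fromEdgeSet {s : Sym2 V | ∃ e, x e = false ∧
          Sum.elim endsN endsF e = s}).ConnectedComponent) = t).card ≤
      (univ.filter fun x : ιN ⊕ ιF → Bool => x ∈ rSet (Sum.elim endsN endsF) a b c ∧
        (Nat.card (fromEdgeSet {s : Sym2 V | ∃ e, x e = true ∧
          Sum.elim endsN endsF e = s}).ConnectedComponent +
        Nat.card (fromEdgeSet {s : Sym2 V | ∃ e, x e = false ∧
          Sum.elim endsN endsF e = s}).ConnectedComponent) = t).card := by
  refine card_lSet_grade_le_of_terminalBlock endsN endsF b a b c hsep ha (fun _ _ => rfl) hcF hcb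
    (fun t' => ?_) t
  have h00 : (univ.filter fun ωN : ιN → Bool => ωN ∈ lSet endsN a b b ∧
      (Nat.card (fromEdgeSet {s : Sym2 V | ∃ i, ωN i = true ∧ endsN i = s}).ConnectedComponent +
        Nat.card (fromEdgeSet {s : Sym2 V | ∃ i, ωN i = false ∧ endsN i = s}).ConnectedComponent) = t') = ∅ :=
    filter_eq_empty_iff.2 fun ωN _ h => by rw [lSet_self] at h; exact absurd h.1 (by simp)
  rw [h00, card_empty]
  exact Nat.zero_le _

end Sets

end AntipodalR1

end Summit.CriticalPhenomena.PercolationContinuityZ3.Theorems
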